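import Summits.CriticalPhenomena.SAWScalingLimit.Theorems.SAWDevelopingMapObservableToSLECanonicalTransferSqueeze
import Summits.CriticalPhenomena.SAWScalingLimit.Theorems.SAWDevelopingMapObservableToSLECanonicalTransferSqueezePendant
import Summits.CriticalPhenomena.SAWScalingLimit.Theorems.SAWDevelopingMapObservableToSLECanonicalTransferLimit
import Summits.CriticalPhenomena.SAWScalingLimit.Theorems.SAWDevelopingMapObservableToSLECanonicalTransferFloor
import Summits.CriticalPhenomena.SAWScalingLimit.Theorems.ObservableToSLE.Negative.Identification
import Literature.Probability.RandomPlanarGeometry.HullSubdomainPullback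
import Literature.Probability.RandomPlanarGeometry.ConformalRectangle
import Literature.Probability.RandomPlanarGeometry.RestrictionHulls
import HarnessLib

/-!
# Crux `SAWDevelopingMap.ObservableToSLE` (stmt-CriticalPhenomena-10472), line
`floor-ratio-restriction-bootstrap`, stub `stub_canonicalTransfer`: ASSEMBLY MODULO THE
DISCRETISATION

Landing target:
`Summits/CriticalPhenomena/SAWScalingLimit/Theorems/SAWDevelopingMapObservableToSLECanonicalTransferAssembly.lean`
(`--supports stmt-CriticalPhenomena-10472`).

`stub_canonicalTransfer` is `AdmissibleRestrictionLimit → FloorRestrictionLimit`: the admissible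
restriction cocycle (`Z_{Λ'δ}/Z_{Λδ} → Φ'_A(0)^{5/8}` for nested admissible vertex-domain families
discretising a hull subdomain `D' ⊆ D` of a floor domain) should give the same limit for the
`hexSAWLaw`-probability (canonical discrete domain `Ω_δ` of `HexSAW.lean`, floor-vertex endpoints)
that the critical walk is a `D'`-mesh walk.  `canonicalTransfer_ofDiscretisation` proves it
MODULO ONE DISCRETISATION INPUT isolating exactly the lattice topology / boundary insensitivity
that is not in the tree (registered sub-goal of this file: `stub_canonicalTransfer_floorBalls`):
for every floor domain `D`, hull subdomain `D'` and floor-vertex endpoints `a, b` there should be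
* (M1) an INNER ADMISSIBLE DISCRETISATION matched to the canonical endpoints: `ρ' ≤ ρ` and
  families `Λ' δ ⊆ Λ'' δ ⊆ Λ δ`, `(Λ, Λ')` admissible for `(D, D', ρ')` in the exact sense of the
  hypothesis (simply connected, connected, exact rows `≥ m δ` in the two balls, exhausting the
  compacts, floor mid-edge endpoints `σa δ → a`, `σb δ → b`), `Λ δ` without bad edges of `Ω_δ`,
  `Λ' δ` without bad `D'`-mesh edges, `Λ'' δ` closed under `D'`-mesh steps inside `Λ δ`, and
  `m δ`, `σa δ`, `σb δ` the row and mid-edges under the canonical endpoints in the two floor cases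
  of `stub_canonicalTransfer_floorCases` (full lowest row: `m = row a`, `σa = {a, (a₁ - e₁, 1)}`;
  pendant: `m = row a + 1`, `σa = {(a₁ + e₁, 0), a}`);
* (M2'a) CANONICAL INSENSITIVITY FROM ABOVE: `P^{can}_δ(γ ⊆ Λ δ ∪ {a δ, b δ}) → 1`;
* (M2'b) `D'`-SIDE INSENSITIVITY FROM ABOVE: `Z_{Λ''δ}(σa, σb)/Z_{Λ'δ}(σa, σb) → 1`
(stated under the cocycle hypothesis, which all three may use).  The proof combines the floor
cases at both endpoints, the fixed-scale squeezes `stub_canonicalTransfer_squeeze(Pendant)`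
(`Z_{Λ'}/Z_Λ ≤ P(E | In) ≤ Z_{Λ''}/Z_Λ`), the cocycle for `(Λ, Λ')` and
`stub_canonicalTransfer_limit`.
-/

noncomputable section

open scoped BigOperators Topology NNReal ENNReal
open Filter Set MeasureTheory Metric
open Literature.Probability.LatticeModels (HexVertex hexGraph hexCenter Site)
open Literature.Probability.RandomPlanarGeometry
open Literature.Probability.RandomPlanarGeometry.SAW
open UpperHalfPlane (upperHalfPlaneSet)

namespace Summit.CriticalPhenomena.SAWScalingLimit.Theorems.ObservableToSLE.FloorRatio

open Summit.CriticalPhenomena.SAWScalingLimit.Theorems.ObservableToSLE.Negative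
  (finite_hexDomainSAW eventually_isProbabilityMeasure_hexSAWLaw)

/-- The floor condition is downward closed in the radius. [folklore] -/
theorem inter_ball_eq_of_le {S H : Set ℂ} {p : ℂ} {ρ ρ' : ℝ} (h : S ∩ ball p ρ = H ∩ ball p ρ)
    (hle : ρ' ≤ ρ) : S ∩ ball p ρ' = H ∩ ball p ρ' := by
  rw [← inter_eq_right.2 (ball_subset_ball hle : ball p ρ' ⊆ ball p ρ), ← inter_assoc,
    ← inter_assoc, h]

/-- Points of the flat part `{im > h} ∩ B(p, R)`, `R ≤ ρ`, lie in the floor domain. [folklore] -/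
theorem mem_of_floor {S : Set ℂ} {hgt : ℝ} {p z : ℂ} {ρ R : ℝ}
    (h : S ∩ ball p ρ = {c : ℂ | hgt < c.im} ∩ ball p ρ) (hle : R ≤ ρ)
    (hz : z ∈ {c : ℂ | hgt < c.im} ∩ ball p R) : z ∈ S :=
  (show z ∈ S ∩ ball p ρ by rw [h]; exact ⟨hz.1, ball_subset_ball hle hz.2⟩).1

/-- Rescaled lattice points next to a convergent lattice point are eventually in a given ball
around the limit. [folklore] -/
theorem eventually_adj_mem_ball {p : ℂ} {a : ℝ → HexVertex} {R : ℝ} (hR : 0 < R)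
    (ha : Tendsto (fun δ : ℝ => (δ : ℂ) * hexCenter (a δ)) (𝓝[>] 0) (𝓝 p)) :
    ∀ᶠ δ : ℝ in 𝓝[>] 0, ∀ w : HexVertex, (w = a δ ∨ hexGraph.Adj (a δ) w) →
      (δ : ℂ) * hexCenter w ∈ ball p R := by
  have h1 : ∀ᶠ δ : ℝ in 𝓝[>] 0, dist ((δ : ℂ) * hexCenter (a δ)) p < R / 2 :=
    Metric.tendsto_nhds.1 ha _ (half_pos hR)
  have h2 : ∀ᶠ δ : ℝ in 𝓝[>] 0, δ ∈ Ioo 0 (R / 2) := Ioo_mem_nhdsGT (half_pos hR)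
  filter_upwards [h1, h2] with δ hd hδ w hw
  rw [mem_ball]
  rcases hw with rfl | hw
  · linarith
  · calc dist ((δ : ℂ) * hexCenter w) p
        ≤ dist ((δ : ℂ) * hexCenter w) ((δ : ℂ) * hexCenter (a δ)) +
            dist ((δ : ℂ) * hexCenter (a δ)) p := dist_triangle _ _ _
      _ < δ + R / 2 := add_lt_add_of_le_of_lt (dist_smul_hexCenter_le_of_adj hδ.1.le hw) hd
      _ < R := by linarith [hδ.2]

/-- **Registered sub-goal `stub_canonicalTransfer_floorBalls`** (crux item
stmt-CriticalPhenomena-10472, line `floor-ratio-restriction-bootstrap`, stub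
`stub_canonicalTransfer`): the canonical endpoint and its honeycomb neighbours are eventually in
any ball around the marked point (registry form of `eventually_adj_mem_ball`). [folklore] -/
theorem stub_canonicalTransfer_floorBalls :
    ∀ (p : ℂ) (a : ℝ → HexVertex) (R : ℝ), 0 < R →
    Tendsto (fun δ : ℝ => (δ : ℂ) * hexCenter (a δ)) (𝓝[>] 0) (𝓝 p) →
    ∀ᶠ δ : ℝ in 𝓝[>] 0, ∀ w : HexVertex, (w = a δ ∨ hexGraph.Adj (a δ) w) →
      (δ : ℂ) * hexCenter w ∈ ball p R :=
  fun _ _ _ hR ha => eventually_adj_mem_ball hR ha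

/-- Two lattice points converging to distinct points are eventually distinct. [folklore] -/
theorem eventually_ne_of_tendsto_hexCenter {p q : ℂ} {a b : ℝ → HexVertex} (hpq : p ≠ q)
    (ha : Tendsto (fun δ : ℝ => (δ : ℂ) * hexCenter (a δ)) (𝓝[>] 0) (𝓝 p))
    (hb : Tendsto (fun δ : ℝ => (δ : ℂ) * hexCenter (b δ)) (𝓝[>] 0) (𝓝 q)) :
    ∀ᶠ δ : ℝ in 𝓝[>] 0, a δ ≠ b δ := by
  have hd : 0 < dist p q / 2 := half_pos (dist_pos.2 hpq)
  filter_upwards [Metric.tendsto_nhds.1 ha _ hd, Metric.tendsto_nhds.1 hb _ hd] with δ h1 h2 heq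
  rw [heq] at h1
  have := dist_triangle_left p q ((δ : ℂ) * hexCenter (b δ))
  linarith

/-- **`stub_canonicalTransfer` modulo the discretisation input** (crux item
stmt-CriticalPhenomena-10472, line `floor-ratio-restriction-bootstrap`): if the admissible
restriction limit yields, for every floor domain, hull subdomain and floor-vertex endpoint
approximation, the discretisation data (M1) + (M2'a) + (M2'b) of the module docstring, then it
implies the floor restriction limit for the canonical law `hexSAWLaw` (the registered statement of
`stub_canonicalTransfer`, verbatim). [cite: LawlerSchrammWerner2004SAW, §3.4 ("SAW satisfies restriction")] -/
theorem canonicalTransfer_ofDiscretisation :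
    ((∀ (D D' : DobrushinDomain) (ρ : ℝ) (φ : ConformalEquiv upperHalfPlaneSet D.carrier)
    (Φ : ConformalEquiv (upperHalfPlaneSet \ φ.pullbackHull D') upperHalfPlaneSet) (d : ℝ)
    (Λ Λ' : ℝ → Finset HexVertex) (m : ℝ → ℤ) (a b : ℝ → Sym2 HexVertex),
    (0 < ρ ∧ (D.pt 1).im = (D.pt 0).im ∧ D.carrier ⊆ {z : ℂ | (D.pt 0).im < z.im} ∧
    D.carrier ∩ ball (D.pt 0) ρ = {z : ℂ | (D.pt 0).im < z.im} ∩ ball (D.pt 0) ρ ∧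
    D.carrier ∩ ball (D.pt 1) ρ = {z : ℂ | (D.pt 1).im < z.im} ∩ ball (D.pt 1) ρ) → D.IsHullSubdomain D' → D.IsChordalUniformizing φ →
    IsRestrictionMap (φ.pullbackHull D') Φ → HasRestrictionDeriv (φ.pullbackHull D') Φ d →
    (∀ᶠ δ : ℝ in 𝓝[>] 0,
    Λ' δ ⊆ Λ δ ∧ hexDomainSimplyConnected (Λ δ) ∧ hexDomainSimplyConnected (Λ' δ) ∧
    (hexGraph.induce (↑(Λ δ) : Set HexVertex)).Preconnected ∧
    (hexGraph.induce (↑(Λ' δ) : Set HexVertex)).Preconnected ∧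
    a δ ∈ hexDomainBoundary (Λ δ) ∧ b δ ∈ hexDomainBoundary (Λ δ) ∧
    a δ ∈ hexDomainBoundary (Λ' δ) ∧ b δ ∈ hexDomainBoundary (Λ' δ) ∧
    Nonempty (HexMidEdgeSAW (Λ' δ) (a δ) (b δ)) ∧
    (∀ v ∈ Λ δ, (δ : ℂ) * hexCenter v ∈ D.carrier ∧ m δ ≤ v.1 1) ∧
    (∀ v ∈ Λ' δ, (δ : ℂ) * hexCenter v ∈ D'.carrier) ∧
    (∀ v : HexVertex, (δ : ℂ) * hexCenter v ∈ ball (D.pt 0) ρ ∪ ball (D.pt 1) ρ →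
    ((v ∈ Λ δ ↔ m δ ≤ v.1 1) ∧ (v ∈ Λ' δ ↔ m δ ≤ v.1 1)))) →
    (∀ K : Set ℂ, IsCompact K → K ⊆ D.carrier →
    ∀ᶠ δ : ℝ in 𝓝[>] 0, ∀ v : HexVertex, (δ : ℂ) * hexCenter v ∈ K → v ∈ Λ δ) →
    (∀ K : Set ℂ, IsCompact K → K ⊆ D'.carrier →
    ∀ᶠ δ : ℝ in 𝓝[>] 0, ∀ v : HexVertex, (δ : ℂ) * hexCenter v ∈ K → v ∈ Λ' δ) →
    Tendsto (fun δ : ℝ => (δ : ℂ) * hexMidpoint (a δ)) (𝓝[>] 0) (𝓝 (D.pt 0)) →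
    Tendsto (fun δ : ℝ => (δ : ℂ) * hexMidpoint (b δ)) (𝓝[>] 0) (𝓝 (D.pt 1)) →
    Tendsto (fun δ : ℝ => (∑ γ : HexMidEdgeSAW (Λ' δ) (a δ) (b δ), hexCriticalFugacity ^ γ.length) /
    (∑ γ : HexMidEdgeSAW (Λ δ) (a δ) (b δ), hexCriticalFugacity ^ γ.length)) (𝓝[>] 0)
    (𝓝 (d ^ ((5 : ℝ) / 8)))) →
    -- the discretisation input (M1) + (M2'a) + (M2'b)
    ∀ (D D' : DobrushinDomain) (ρ : ℝ) (a b : ℝ → HexVertex),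
    (0 < ρ ∧ (D.pt 1).im = (D.pt 0).im ∧ D.carrier ⊆ {z : ℂ | (D.pt 0).im < z.im} ∧
    D.carrier ∩ ball (D.pt 0) ρ = {z : ℂ | (D.pt 0).im < z.im} ∩ ball (D.pt 0) ρ ∧
    D.carrier ∩ ball (D.pt 1) ρ = {z : ℂ | (D.pt 1).im < z.im} ∩ ball (D.pt 1) ρ) →
    D.IsHullSubdomain D' →
    (IsEmbEndpointApprox hexGraph hexCenter D a b ∧ ∀ᶠ δ : ℝ in 𝓝[>] 0,
    (∃ u : HexVertex, hexGraph.Adj (a δ) u ∧ ((δ : ℂ) * hexCenter u).im ≤ (D.pt 0).im) ∧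
    (∃ u : HexVertex, hexGraph.Adj (b δ) u ∧ ((δ : ℂ) * hexCenter u).im ≤ (D.pt 1).im)) →
    ∃ (ρ' : ℝ) (Λ Λ' Λ'' : ℝ → Finset HexVertex) (m : ℝ → ℤ) (σa σb : ℝ → Sym2 HexVertex),
    0 < ρ' ∧ ρ' ≤ ρ ∧
    (∀ᶠ δ : ℝ in 𝓝[>] 0,
    Λ' δ ⊆ Λ δ ∧ hexDomainSimplyConnected (Λ δ) ∧ hexDomainSimplyConnected (Λ' δ) ∧
    (hexGraph.induce (↑(Λ δ) : Set HexVertex)).Preconnected ∧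
    (hexGraph.induce (↑(Λ' δ) : Set HexVertex)).Preconnected ∧
    σa δ ∈ hexDomainBoundary (Λ δ) ∧ σb δ ∈ hexDomainBoundary (Λ δ) ∧
    σa δ ∈ hexDomainBoundary (Λ' δ) ∧ σb δ ∈ hexDomainBoundary (Λ' δ) ∧
    Nonempty (HexMidEdgeSAW (Λ' δ) (σa δ) (σb δ)) ∧
    (∀ v ∈ Λ δ, (δ : ℂ) * hexCenter v ∈ D.carrier ∧ m δ ≤ v.1 1) ∧
    (∀ v ∈ Λ' δ, (δ : ℂ) * hexCenter v ∈ D'.carrier) ∧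
    (∀ v : HexVertex, (δ : ℂ) * hexCenter v ∈ ball (D.pt 0) ρ' ∪ ball (D.pt 1) ρ' →
    ((v ∈ Λ δ ↔ m δ ≤ v.1 1) ∧ (v ∈ Λ' δ ↔ m δ ≤ v.1 1)))) ∧
    (∀ K : Set ℂ, IsCompact K → K ⊆ D.carrier →
    ∀ᶠ δ : ℝ in 𝓝[>] 0, ∀ v : HexVertex, (δ : ℂ) * hexCenter v ∈ K → v ∈ Λ δ) ∧
    (∀ K : Set ℂ, IsCompact K → K ⊆ D'.carrier →
    ∀ᶠ δ : ℝ in 𝓝[>] 0, ∀ v : HexVertex, (δ : ℂ) * hexCenter v ∈ K → v ∈ Λ' δ) ∧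
    Tendsto (fun δ : ℝ => (δ : ℂ) * hexMidpoint (σa δ)) (𝓝[>] 0) (𝓝 (D.pt 0)) ∧
    Tendsto (fun δ : ℝ => (δ : ℂ) * hexMidpoint (σb δ)) (𝓝[>] 0) (𝓝 (D.pt 1)) ∧
    (∀ᶠ δ : ℝ in 𝓝[>] 0,
    Λ' δ ⊆ Λ'' δ ∧ Λ'' δ ⊆ Λ δ ∧
    (∀ v ∈ Λ δ, ∀ w ∈ Λ δ, hexGraph.Adj v w → (hexDomainGraph D.carrier δ).Adj v w) ∧
    (∀ v ∈ Λ' δ, ∀ w ∈ Λ' δ, hexGraph.Adj v w →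
    (embMeshGraph hexGraph hexCenter D'.carrier δ).Adj v w) ∧
    (∀ v ∈ Λ'' δ, ∀ w ∈ Λ δ, (δ : ℂ) * hexCenter w ∈ D'.carrier →
    (embMeshGraph hexGraph hexCenter D'.carrier δ).Adj v w → w ∈ Λ'' δ) ∧
    ((a δ).2 = 0 → m δ = (a δ).1 1 ∧ σa δ = s(a δ, ((a δ).1 - Pi.single 1 1, (1 : Fin 2)))) ∧
    ((a δ).2 = 1 → m δ = (a δ).1 1 + 1 ∧
    σa δ = s((((a δ).1 + Pi.single 1 1, (0 : Fin 2)) : HexVertex), a δ)) ∧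
    ((b δ).2 = 0 → σb δ = s(b δ, ((b δ).1 - Pi.single 1 1, (1 : Fin 2)))) ∧
    ((b δ).2 = 1 → σb δ = s((((b δ).1 + Pi.single 1 1, (0 : Fin 2)) : HexVertex), b δ))) ∧
    Tendsto (fun δ : ℝ => ((hexSAWLaw D.carrier δ (a δ) (b δ))
    {γ | ∀ v ∈ γ.walk.support, v ∈ Λ δ ∨ v = a δ ∨ v = b δ}).toReal) (𝓝[>] 0) (𝓝 1) ∧
    Tendsto (fun δ : ℝ =>
    (∑ γ : HexMidEdgeSAW (Λ'' δ) (σa δ) (σb δ), hexCriticalFugacity ^ γ.length) /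
    (∑ γ : HexMidEdgeSAW (Λ' δ) (σa δ) (σb δ), hexCriticalFugacity ^ γ.length))
    (𝓝[>] 0) (𝓝 1)) →
    -- the registered statement of `stub_canonicalTransfer`, verbatim
    (
    ∀ (D D' : DobrushinDomain) (ρ : ℝ) (φ : ConformalEquiv upperHalfPlaneSet D.carrier)
    (Φ : ConformalEquiv (upperHalfPlaneSet \ φ.pullbackHull D') upperHalfPlaneSet) (d : ℝ)
    (Λ Λ' : ℝ → Finset HexVertex) (m : ℝ → ℤ) (a b : ℝ → Sym2 HexVertex),
    (0 < ρ ∧ (D.pt 1).im = (D.pt 0).im ∧ D.carrier ⊆ {z : ℂ | (D.pt 0).im < z.im} ∧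
    D.carrier ∩ ball (D.pt 0) ρ = {z : ℂ | (D.pt 0).im < z.im} ∩ ball (D.pt 0) ρ ∧
    D.carrier ∩ ball (D.pt 1) ρ = {z : ℂ | (D.pt 1).im < z.im} ∩ ball (D.pt 1) ρ) → D.IsHullSubdomain D' → D.IsChordalUniformizing φ →
    IsRestrictionMap (φ.pullbackHull D') Φ → HasRestrictionDeriv (φ.pullbackHull D') Φ d →
    (∀ᶠ δ : ℝ in 𝓝[>] 0,
    Λ' δ ⊆ Λ δ ∧ hexDomainSimplyConnected (Λ δ) ∧ hexDomainSimplyConnected (Λ' δ) ∧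
    (hexGraph.induce (↑(Λ δ) : Set HexVertex)).Preconnected ∧
    (hexGraph.induce (↑(Λ' δ) : Set HexVertex)).Preconnected ∧
    a δ ∈ hexDomainBoundary (Λ δ) ∧ b δ ∈ hexDomainBoundary (Λ δ) ∧
    a δ ∈ hexDomainBoundary (Λ' δ) ∧ b δ ∈ hexDomainBoundary (Λ' δ) ∧
    Nonempty (HexMidEdgeSAW (Λ' δ) (a δ) (b δ)) ∧
    (∀ v ∈ Λ δ, (δ : ℂ) * hexCenter v ∈ D.carrier ∧ m δ ≤ v.1 1) ∧
    (∀ v ∈ Λ' δ, (δ : ℂ) * hexCenter v ∈ D'.carrier) ∧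
    (∀ v : HexVertex, (δ : ℂ) * hexCenter v ∈ ball (D.pt 0) ρ ∪ ball (D.pt 1) ρ →
    ((v ∈ Λ δ ↔ m δ ≤ v.1 1) ∧ (v ∈ Λ' δ ↔ m δ ≤ v.1 1)))) →
    (∀ K : Set ℂ, IsCompact K → K ⊆ D.carrier →
    ∀ᶠ δ : ℝ in 𝓝[>] 0, ∀ v : HexVertex, (δ : ℂ) * hexCenter v ∈ K → v ∈ Λ δ) →
    (∀ K : Set ℂ, IsCompact K → K ⊆ D'.carrier →
    ∀ᶠ δ : ℝ in 𝓝[>] 0, ∀ v : HexVertex, (δ : ℂ) * hexCenter v ∈ K → v ∈ Λ' δ) →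
    Tendsto (fun δ : ℝ => (δ : ℂ) * hexMidpoint (a δ)) (𝓝[>] 0) (𝓝 (D.pt 0)) →
    Tendsto (fun δ : ℝ => (δ : ℂ) * hexMidpoint (b δ)) (𝓝[>] 0) (𝓝 (D.pt 1)) →
    Tendsto (fun δ : ℝ => (∑ γ : HexMidEdgeSAW (Λ' δ) (a δ) (b δ), hexCriticalFugacity ^ γ.length) /
    (∑ γ : HexMidEdgeSAW (Λ δ) (a δ) (b δ), hexCriticalFugacity ^ γ.length)) (𝓝[>] 0)
    (𝓝 (d ^ ((5 : ℝ) / 8)))) →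
  ∀ (D D' : DobrushinDomain) (ρ : ℝ) (φ : ConformalEquiv upperHalfPlaneSet D.carrier)
  (Φ : ConformalEquiv (upperHalfPlaneSet \ φ.pullbackHull D') upperHalfPlaneSet) (d : ℝ)
  (a b : ℝ → HexVertex),
  (0 < ρ ∧ (D.pt 1).im = (D.pt 0).im ∧ D.carrier ⊆ {z : ℂ | (D.pt 0).im < z.im} ∧
  D.carrier ∩ ball (D.pt 0) ρ = {z : ℂ | (D.pt 0).im < z.im} ∩ ball (D.pt 0) ρ ∧
  D.carrier ∩ ball (D.pt 1) ρ = {z : ℂ | (D.pt 1).im < z.im} ∩ ball (D.pt 1) ρ) → D.IsHullSubdomain D' → D.IsChordalUniformizing φ →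
  IsRestrictionMap (φ.pullbackHull D') Φ → HasRestrictionDeriv (φ.pullbackHull D') Φ d →
  (IsEmbEndpointApprox hexGraph hexCenter D a b ∧ ∀ᶠ δ : ℝ in 𝓝[>] 0,
  (∃ u : HexVertex, hexGraph.Adj (a δ) u ∧ ((δ : ℂ) * hexCenter u).im ≤ (D.pt 0).im) ∧
  (∃ u : HexVertex, hexGraph.Adj (b δ) u ∧ ((δ : ℂ) * hexCenter u).im ≤ (D.pt 1).im)) →
  Tendsto (fun δ : ℝ => ((hexSAWLaw D.carrier δ (a δ) (b δ))
  {γ | (∀ v ∈ γ.walk.support, v ∈ embMeshVertices hexCenter D'.carrier δ) ∧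
  ∀ e ∈ γ.walk.darts,
  (embMeshGraph hexGraph hexCenter D'.carrier δ).Adj e.fst e.snd}).toReal)
  (𝓝[>] 0) (𝓝 (d ^ ((5 : ℝ) / 8))) := by
  intro hDisc hARL D D' ρ φ Φ d a b hfl hD' hφ hΦ hd hend
  obtain ⟨hab, hend'⟩ := hend
  obtain ⟨ρ', Λ, Λ', Λ'', m, σa, σb, hρ'0, hρ'ρ, hADM, hK, hK', hσa, hσb, hL, hM2a, hM2b⟩ :=
    hDisc hARL D D' ρ a b hfl hD' ⟨hab, hend'⟩
  obtain ⟨hρ0, hpt, hDh, hfl0, hfl1⟩ := hfl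
  -- the cocycle for the inner pair `(Λ, Λ')`
  have hT1 := hARL D D' ρ' φ Φ d Λ Λ' m σa σb
    ⟨hρ'0, hpt, hDh, inter_ball_eq_of_le hfl0 hρ'ρ, inter_ball_eq_of_le hfl1 hρ'ρ⟩ hD' hφ hΦ hd hADM
    hK hK' hσa hσb
  obtain ⟨r0, hr0, hr0D'⟩ := Metric.eventually_nhds_iff.1 (hD'.eventually_mem 0)
  obtain ⟨r1, hr1, hr1D'⟩ := Metric.eventually_nhds_iff.1 (hD'.eventually_mem 1)
  set R : ℝ := min ρ' (min r0 r1) with hRdef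
  have hR0 : 0 < R := lt_min hρ'0 (lt_min hr0 hr1)
  have hRρ' : R ≤ ρ' := min_le_left _ _
  obtain ⟨hRρ, hRr0, hRr1⟩ : R ≤ ρ ∧ R ≤ r0 ∧ R ≤ r1 := ⟨hRρ'.trans hρ'ρ,
    (min_le_right _ _).trans (min_le_left _ _), (min_le_right _ _).trans (min_le_right _ _)⟩
  have hballa := eventually_adj_mem_ball hR0 hab.tendsto_fst
  have hballb := eventually_adj_mem_ball hR0 hab.tendsto_snd
  have hne := eventually_ne_of_tendsto_hexCenter (D.pt_injective.ne (by decide)) hab.tendsto_fst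
    hab.tendsto_snd
  -- the fixed-scale squeeze, eventually
  have hsq : ∀ᶠ δ : ℝ in 𝓝[>] 0,
      (((hexSAWLaw D.carrier δ (a δ) (b δ))
          {γ | ∀ v ∈ γ.walk.support, v ∈ Λ δ ∨ v = a δ ∨ v = b δ}).toReal *
            ∑ γ : HexMidEdgeSAW (Λ' δ) (σa δ) (σb δ), hexCriticalFugacity ^ γ.length ≤
          ((hexSAWLaw D.carrier δ (a δ) (b δ))
              ({γ | (∀ v ∈ γ.walk.support, v ∈ embMeshVertices hexCenter D'.carrier δ) ∧
                  ∀ e ∈ γ.walk.darts,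
                    (embMeshGraph hexGraph hexCenter D'.carrier δ).Adj e.fst e.snd} ∩
                {γ | ∀ v ∈ γ.walk.support, v ∈ Λ δ ∨ v = a δ ∨ v = b δ})).toReal *
            ∑ γ : HexMidEdgeSAW (Λ δ) (σa δ) (σb δ), hexCriticalFugacity ^ γ.length ∧
        ((hexSAWLaw D.carrier δ (a δ) (b δ))
              ({γ | (∀ v ∈ γ.walk.support, v ∈ embMeshVertices hexCenter D'.carrier δ) ∧
                  ∀ e ∈ γ.walk.darts,
                    (embMeshGraph hexGraph hexCenter D'.carrier δ).Adj e.fst e.snd} ∩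
                {γ | ∀ v ∈ γ.walk.support, v ∈ Λ δ ∨ v = a δ ∨ v = b δ})).toReal *
            ∑ γ : HexMidEdgeSAW (Λ δ) (σa δ) (σb δ), hexCriticalFugacity ^ γ.length ≤
          ((hexSAWLaw D.carrier δ (a δ) (b δ))
              {γ | ∀ v ∈ γ.walk.support, v ∈ Λ δ ∨ v = a δ ∨ v = b δ}).toReal *
            ∑ γ : HexMidEdgeSAW (Λ'' δ) (σa δ) (σb δ), hexCriticalFugacity ^ γ.length) ∧
        σa δ ≠ σb δ := by
    filter_upwards [self_mem_nhdsWithin, hADM, hL, hend', hab.reachable, hballa, hballb, hne]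
      with δ hδ hA hB hE hReach hBa hBb hab'
    obtain ⟨hΛ'Λ, -, -, -, -, -, -, -, -, -, hΛD, hΛ'D', hrow⟩ := hA
    obtain ⟨hΛ'Λ'', hΛ''Λ, hbad, hbad', hcl, ha0c, ha1c, hb0c, hb1c⟩ := hB
    obtain ⟨⟨ua, hua, huaim⟩, ⟨ub, hub, hubim⟩⟩ := hE
    have hδ0 : (0 : ℝ) < δ := hδ
    haveI : Finite (HexDomainSAW D.carrier δ (a δ) (b δ)) := finite_hexDomainSAW D.isBounded hδ0.ne' _ _
    letI : Fintype (HexDomainSAW D.carrier δ (a δ) (b δ)) := Fintype.ofFinite _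
    obtain ⟨wa, hwa⟩ := exists_adj_of_reachable hReach hab'
    obtain ⟨wb, hwb⟩ := exists_adj_of_reachable hReach.symm hab'.symm
    have haIm : (D.pt 0).im < ((δ : ℂ) * hexCenter (a δ)).im :=
      hDh (embMeshDomain_subset _ _ _ _ (mem_embMeshDomain_of_adj hwa))
    have hbIm : (D.pt 0).im < ((δ : ℂ) * hexCenter (b δ)).im :=
      hDh (embMeshDomain_subset _ _ _ _ (mem_embMeshDomain_of_adj hwb))
    rw [hpt] at hubim
    have hout : ∀ u : HexVertex, ((δ : ℂ) * hexCenter u).im ≤ (D.pt 0).im → u ∉ Λ δ :=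
      fun u hu huΛ => (hDh (hΛD u huΛ).1).not_ge hu
    rcases floor_cases_pair hδ0 hua haIm huaim hub hbIm hubim with
      ⟨ha0, hb0, hrowab, rfl, rfl⟩ | ⟨ha1, hb1, hrowab, hax, hbx⟩
    · obtain ⟨hm, hσa'⟩ := ha0c ha0  -- full lowest row
      have hσb' := hb0c hb0
      have haΛ' : a δ ∈ Λ' δ :=
        ((hrow (a δ) (Or.inl (ball_subset_ball hRρ' (hBa _ (Or.inl rfl))))).2).2 (by rw [hm])
      have hbΛ' : b δ ∈ Λ' δ :=
        ((hrow (b δ) (Or.inr (ball_subset_ball hRρ' (hBb _ (Or.inl rfl))))).2).2 (by rw [hm, hrowab])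
      have huaΛ : ((a δ).1 - Pi.single 1 1, (1 : Fin 2)) ∉ Λ δ := hout _ huaim
      have hubΛ : ((b δ).1 - Pi.single 1 1, (1 : Fin 2)) ∉ Λ δ := hout _ hubim
      have hsab : s(a δ, ((a δ).1 - Pi.single 1 1, (1 : Fin 2))) ≠
          s(b δ, ((b δ).1 - Pi.single 1 1, (1 : Fin 2))) :=
        sym2_ne_of_ne hab' fun h => hubΛ (h ▸ hΛ''Λ (hΛ'Λ'' haΛ'))
      have hz := measure_meshEvent_inter_inside_squeeze (Ω := D.carrier) (Ω' := D'.carrier)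
        hbad hΛ'Λ'' hΛ''Λ hΛ'D' hbad' hcl haΛ' hbΛ' huaΛ hubΛ hua hsab
      rw [hσa', hσb']
      exact ⟨hz, hsab⟩
    · obtain ⟨hm, hσa'⟩ := ha1c ha1  -- pendant lowest row
      have hσb' := hb1c hb1
      have ha_eq : a δ = ((a δ).1, (1 : Fin 2)) := Prod.ext rfl ha1
      have hb_eq : b δ = ((b δ).1, (1 : Fin 2)) := Prod.ext rfl hb1
      have hka : ∀ w, (hexDomainGraph D.carrier δ).Adj (a δ) w →
          w = ((a δ).1 + Pi.single 1 1, (0 : Fin 2)) := fun w hw => by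
        have hwD := embMeshDomain_subset _ _ _ _ (mem_embMeshDomain_of_adj hw.symm)
        have hw' : hexGraph.Adj ((a δ).1, (1 : Fin 2)) w := ha_eq ▸ embDomainGraph_le _ _ _ _ hw
        exact floor_pendant_neighbour hδ0 hax hw' (hDh hwD)
      have hkb : ∀ w, (hexDomainGraph D.carrier δ).Adj (b δ) w →
          w = ((b δ).1 + Pi.single 1 1, (0 : Fin 2)) := fun w hw => by
        have hwD := embMeshDomain_subset _ _ _ _ (mem_embMeshDomain_of_adj hw.symm)
        have hw' : hexGraph.Adj ((b δ).1, (1 : Fin 2)) w := hb_eq ▸ embDomainGraph_le _ _ _ _ hw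
        exact floor_pendant_neighbour hδ0 hbx hw' (hDh hwD)
      have haa' : (hexDomainGraph D.carrier δ).Adj (a δ) ((a δ).1 + Pi.single 1 1, (0 : Fin 2)) :=
        hka wa hwa ▸ hwa
      have hbb' : (hexDomainGraph D.carrier δ).Adj (b δ) ((b δ).1 + Pi.single 1 1, (0 : Fin 2)) :=
        hkb wb hwb ▸ hwb
      have huniqa : ∀ w, (hexDomainGraph D.carrier δ).Adj (a δ) w ↔
          w = ((a δ).1 + Pi.single 1 1, (0 : Fin 2)) := fun w => ⟨hka w, fun h => h ▸ haa'⟩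
      have huniqb : ∀ w, (hexDomainGraph D.carrier δ).Adj (b δ) w ↔
          w = ((b δ).1 + Pi.single 1 1, (0 : Fin 2)) := fun w => ⟨hkb w, fun h => h ▸ hbb'⟩
      have hadja : hexGraph.Adj (a δ) ((a δ).1 + Pi.single 1 1, (0 : Fin 2)) :=
        embDomainGraph_le _ _ _ _ haa'
      have hadjb : hexGraph.Adj (b δ) ((b δ).1 + Pi.single 1 1, (0 : Fin 2)) :=
        embDomainGraph_le _ _ _ _ hbb'
      have ha'B := hBa _ (Or.inr hadja)
      have hb'B := hBb _ (Or.inr hadjb)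
      have ha'Λ' : ((a δ).1 + Pi.single 1 1, (0 : Fin 2)) ∈ Λ' δ :=
        ((hrow _ (Or.inl (ball_subset_ball hRρ' ha'B))).2).2 (by simp [hm])
      have hb'Λ' : ((b δ).1 + Pi.single 1 1, (0 : Fin 2)) ∈ Λ' δ :=
        ((hrow _ (Or.inr (ball_subset_ball hRρ' hb'B))).2).2 (by simp [hm, hrowab])
      have haΛ : a δ ∉ Λ δ := fun h =>
        absurd (((hrow (a δ) (Or.inl (ball_subset_ball hRρ' (hBa _ (Or.inl rfl))))).1).1 h)
          (by rw [hm]; omega)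
      have hbΛ : b δ ∉ Λ δ := fun h =>
        absurd (((hrow (b δ) (Or.inr (ball_subset_ball hRρ' (hBb _ (Or.inl rfl))))).1).1 h)
          (by rw [hm, ← hrowab]; omega)
      have ha'b : ((a δ).1 + Pi.single 1 1, (0 : Fin 2)) ≠ b δ :=
        fun h => hbΛ (h ▸ hΛ''Λ (hΛ'Λ'' ha'Λ'))
      have haflat : (δ : ℂ) * hexCenter (a δ) ∈ {c : ℂ | (D.pt 0).im < c.im} ∩ ball (D.pt 0) R :=
        ⟨haIm, hBa _ (Or.inl rfl)⟩
      have ha'flat : (δ : ℂ) * hexCenter ((a δ).1 + Pi.single 1 1, (0 : Fin 2)) ∈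
          {c : ℂ | (D.pt 0).im < c.im} ∩ ball (D.pt 0) R :=
        ⟨hDh (hΛD _ (hΛ'Λ ha'Λ')).1, ha'B⟩
      have hbflat : (δ : ℂ) * hexCenter (b δ) ∈ {c : ℂ | (D.pt 1).im < c.im} ∩ ball (D.pt 1) R :=
        ⟨hpt ▸ hbIm, hBb _ (Or.inl rfl)⟩
      have hb'flat : (δ : ℂ) * hexCenter ((b δ).1 + Pi.single 1 1, (0 : Fin 2)) ∈
          {c : ℂ | (D.pt 1).im < c.im} ∩ ball (D.pt 1) R :=
        ⟨hpt ▸ hDh (hΛD _ (hΛ'Λ hb'Λ')).1, hb'B⟩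
      have hD'0 : ∀ z ∈ {c : ℂ | (D.pt 0).im < c.im} ∩ ball (D.pt 0) R, z ∈ D'.carrier :=
        fun z hz => hr0D' (lt_of_lt_of_le (mem_ball.1 hz.2) hRr0) (mem_of_floor hfl0 hRρ hz)
      have hD'1 : ∀ z ∈ {c : ℂ | (D.pt 1).im < c.im} ∩ ball (D.pt 1) R, z ∈ D'.carrier :=
        fun z hz => hr1D' (lt_of_lt_of_le (mem_ball.1 hz.2) hRr1) (mem_of_floor hfl1 hRρ hz)
      have haΩ' : a δ ∈ embMeshVertices hexCenter D'.carrier δ := hD'0 _ haflat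
      have hbΩ' : b δ ∈ embMeshVertices hexCenter D'.carrier δ := hD'1 _ hbflat
      have haa'G : (embMeshGraph hexGraph hexCenter D'.carrier δ).Adj (a δ)
          ((a δ).1 + Pi.single 1 1, (0 : Fin 2)) :=
        (embMeshGraph_adj_iff _ _).2 ⟨hadja, fun z hz =>
          subset_closure (hD'0 z (segment_subset_of_floor haflat ha'flat hz))⟩
      have hb'bG : (embMeshGraph hexGraph hexCenter D'.carrier δ).Adj
          ((b δ).1 + Pi.single 1 1, (0 : Fin 2)) (b δ) :=
        ((embMeshGraph_adj_iff _ _).2 ⟨hadjb, fun z hz =>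
          subset_closure (hD'1 z (segment_subset_of_floor hbflat hb'flat hz))⟩).symm
      have hsab : s((((a δ).1 + Pi.single 1 1, (0 : Fin 2)) : HexVertex), a δ) ≠
          s((((b δ).1 + Pi.single 1 1, (0 : Fin 2)) : HexVertex), b δ) := by
        intro h
        rcases Sym2.eq_iff.1 h with ⟨-, h2⟩ | ⟨h1, -⟩
        · exact hab' h2
        · exact ha'b h1
      have hz := stub_canonicalTransfer_squeezePendant D.carrier D'.carrier δ (Λ δ) (Λ' δ) (Λ'' δ)
        (a δ) (b δ) _ _ hbad hΛ'Λ'' hΛ''Λ hΛ'D' hbad' hcl hab' haΛ hbΛ ha'Λ' hb'Λ' ha'b huniqa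
        huniqb haΩ' hbΩ' haa'G hb'bG
      rw [hσa', hσb']
      exact ⟨hz, hsab⟩
  have hpos : ∀ᶠ δ : ℝ in 𝓝[>] 0,
      0 < ∑ γ : HexMidEdgeSAW (Λ' δ) (σa δ) (σb δ), hexCriticalFugacity ^ γ.length ∧
        0 < ∑ γ : HexMidEdgeSAW (Λ δ) (σa δ) (σb δ), hexCriticalFugacity ^ γ.length := by
    filter_upwards [hADM] with δ hA
    obtain ⟨hΛ'Λ, -, -, -, -, -, -, -, -, hN, -⟩ := hA
    have h1 := sum_pow_length_pos hN
    exact ⟨h1, h1.trans_le (sum_pow_length_mono hΛ'Λ)⟩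
  -- `P(E ∩ In) ≤ P(E) ≤ P(E ∩ In) + 1 - P(In)`, and the limit
  exact tendsto_of_ratio_squeeze hT1 hM2b hM2a hpos (hsq.mono fun δ h => h.1)
    ((eventually_isProbabilityMeasure_hexSAWLaw hab).mono fun δ hP =>
      toReal_inter_le_and_le _ _ _ MeasurableSpace.measurableSet_top)

end Summit.CriticalPhenomena.SAWScalingLimit.Theorems.ObservableToSLE.FloorRatio

end
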